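import Summits.AnomalousDissipation.AnomalousDissipation.Theses.TameRoughRigidity
import Summits.AnomalousDissipation.AnomalousDissipation.Theorems.TameRoughRigidityTameToRoughResidual
import Summits.AnomalousDissipation.AnomalousDissipation.Theorems.TameRoughRigidityResidualTransferSSS
import Literature.Analysis.FluidPDE.StatisticalSolutions
import HarnessLib

/-!
# The zeroth-law CONTENT of `TameRoughRigidity.TameToRough` (stmt-AnomalousDissipation-18401) —
# the redirect strategist's summit-strength certificate (crux-strategist r1, 2026-08-17)

R = `TameToRough` (conditional Onsager calibration for the Galloway–Proctor force `f_GP`) is, with the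
closure lemma K landed, exactly `N → X` (`tameToRough_iff_coercive_imp_target`, N = `GPEulerCoercive`,
X = `GPStatisticalRigidity`). This file records, as named kernel-checked facts, WHAT THAT RESIDUAL
CONTAINS and WHAT THE ROUTE ACTUALLY CONSUMES of it:

* the GP ENSEMBLE FLOOR (stated inline; no new definition) — the ENSEMBLE ZEROTH LAW FOR `f_GP` IN FLOOR FORM: at every energy level `E` there
  is `ε₀(E) > 0` such that every stationary statistical solution of NS_ν(`f_GP`), `ν ∈ (0,1]`, with
  integrable energy `≤ E` dissipates at mean rate `ν·G(μ) ≥ ε₀`. (The Literature conjecture leaf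
  `Literature.Analysis.FluidPDE.EnsembleZerothLawAt f` — turb.S08, FMRT 2001 Ch. V / Frisch 1995 §5.2,
  "nowhere in print … proved for any force" — is its sequential form given any bounded-energy family of
  such statistics: `ensembleZerothLawAt_gp_of_floor`.)
* `gpEnsembleFloor_of_target` — **X ⇒ floor** (the `floor` block of the route's deciding theorem, now
  citeable), via the LANDED residual transfer (defect `≤ ν√G` for NS statistics, item 18616):
  with `R := ν√G` either `R ≤ δ₀` and rigidity pays `c ≤ R√G = νG`, or `νG ≥ R² > δ₀²`.
* `gpEnsembleFloor_of_tameToRough` — **R ∧ N ⇒ floor**: under the route's own existence crux N the crux R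
  CONTAINS the ensemble zeroth law for `f_GP` at every energy level (census F6 made a theorem). This is the
  precise sense in which R is "not short of the summit": the summit `AnomalousDissipation` is the zeroth
  law `∃ f, …` and R ∧ N delivers its dissipation half for the pinned `f = f_GP`, level by level.
* `anomalousDissipation_of_gpEnsembleFloor` — **the route consumes no more than the floor**:
  `floor → GPMeanBoundedFamily → EnsembleFloorTransfer → AnomalousDissipation`, i.e. the
  deciding theorem goes through with the floor in place of `(N, K, R, ResidualTransferSSS)`. R's surplus
  over the floor — rigidity for near-statistics that are NOT Navier–Stokes statistics (symmetrised,
  mollified, Galerkin, convex-integration objects …) — is never used by `closes`; a tribunal re-target of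
  the Onsager node to the floor loses nothing for this route and drops N and K from its cone.

Nothing here asserts a Theses statement. The file ends with the conjunction `stub_zerothLawContentTools`.

## References

* C. Foias, O. Manley, R. Rosa, R. Temam, *Navier–Stokes Equations and Turbulence*, CUP (2001), Ch. IV
  §1.2 Def. 1.3, (1.29)–(1.31); Ch. V §1 (`ε = ν⟨‖∇u‖²⟩`). [FoiasManleyRosaTemam2001]
* U. Frisch, *Turbulence* (CUP 1995) §5.2, §6.1 H3 (the dissipation law as a hypothesis). [Frisch1995]
* C. Doering, C. Foias, J. Fluid Mech. 467 (2002) §2 (mean dissipation / mean energy framework). [DoeringFoias2002]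
* Tree: `Theorems/TameRoughRigidityTameToRoughResidual.lean` (p163702), `Theorems/TameToRough/Negative/Structure.lean`
  (p143720), `Theorems/TameRoughRigidityResidualTransferSSS.lean` (item 18616), `Cruxes/TameToRough/STRATEGY-CENSUS*.md`.
-/

set_option linter.dupNamespace false

noncomputable section

namespace Summit.AnomalousDissipation.AnomalousDissipation.Theorems.TameRoughRigidity.TameToRough

open MeasureTheory Filter Topology
open Literature.Analysis.FunctionSpaces Literature.Analysis.FluidPDE
open Summit.AnomalousDissipation.AnomalousDissipation.Theses.TameRoughRigidity
open Summit.AnomalousDissipation.AnomalousDissipation.Theorems.GPStatisticalRigidity.Negative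
open Summit.AnomalousDissipation.AnomalousDissipation.Theorems.TameToRough.Negative

/-! ### §1 The ensemble zeroth law for `f_GP`, floor form -/

/-! **GP ENSEMBLE FLOOR** (written INLINE below, no new definition is introduced in `Theorems/`): the
ensemble zeroth law for the pinned force `f_GP`, level by level —
`∀ E, ∃ ε₀ > 0, ∀ ν ∈ (0,1], ∀ μ, IsStationaryStatisticalSolution ν f_GP μ → Integrable ‖v‖² → ensembleEnergy μ ≤ E →
ε₀ ≤ ensembleDissipation ν μ` (`ensembleDissipation ν μ = ν·G(μ)`). -/

/-! ### §2 X ⇒ floor (the `floor` block of `closes`, via the landed residual transfer) -/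

/-- **X ⇒ floor, with the residual transfer as an explicit hypothesis.** For an NS_ν(`f_GP`) statistics at
level `E` the residual transfer gives shell work `≥ 0` and cylindrical forced-Euler defect `≤ ν√G·‖∇Φ'‖`; with
`R := ν√G`: if `R ≤ δ₀(E)` then X pays `c ≤ R√G = νG`; otherwise `νG = R²/ν ≥ R² > δ₀²`. So
`ε₀ := min c δ₀²` is a floor. -/
theorem gpEnsembleFloor_of_target_of_residualTransfer (hX : GPStatisticalRigidity)
    (h₅ : ResidualTransferSSS) :
    (∀ E : ℝ, ∃ ε₀ : ℝ, 0 < ε₀ ∧ ∀ ν : ℝ, 0 < ν → ν ≤ 1 →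
      ∀ μ : Measure (Torus.energySpace (Fin 3)), Torus.IsStationaryStatisticalSolution ν gpForce μ →
        Integrable (fun v : Torus.energySpace (Fin 3) => ‖v‖ ^ 2) μ → Torus.ensembleEnergy μ ≤ E →
          ε₀ ≤ Torus.ensembleDissipation ν μ) := by
  intro E
  obtain ⟨hsm, hdf, hzm⟩ :=
    Summit.AnomalousDissipation.AnomalousDissipation.Theorems.SteadyStatesLoudBounded.GpAdmissible.stub_gpAdmissible
  obtain ⟨c, δ₀, hc, hδ₀, hrig⟩ := hX gpForce rfl E
  refine ⟨min c (δ₀ ^ 2), lt_min hc (pow_pos hδ₀ 2), ?_⟩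
  intro ν' hν' hν'1 μ hμ hint hEμ
  have hfin : Torus.ensembleEnstrophy μ < ⊤ := hμ.enstrophy_finite
  obtain ⟨hshell, hres⟩ := h₅ ν' gpForce μ hν' hsm hdf hzm hμ hint
  set G : ℝ := (Torus.ensembleEnstrophy μ).toReal with hG
  have hG0 : 0 ≤ G := ENNReal.toReal_nonneg
  have hsq : Real.sqrt G * Real.sqrt G = G := Real.mul_self_sqrt hG0
  set R : ℝ := ν' * Real.sqrt G with hR
  have hR0 : 0 ≤ R := mul_nonneg hν'.le (Real.sqrt_nonneg _)
  have hdiss : Torus.ensembleDissipation ν' μ = ν' * G := rfl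
  rw [hdiss]
  by_cases hRδ : R ≤ δ₀
  · -- rigidity branch: c ≤ R √G = ν' G
    have key := hrig μ hμ.prob hint hEμ hfin hshell R hR0 hRδ
      (fun Φ => ⟨(hres Φ).1, by simpa [hR, mul_assoc] using (hres Φ).2⟩)
    have : R * Real.sqrt G = ν' * G := by rw [hR, mul_assoc, hsq]
    calc min c (δ₀ ^ 2) ≤ c := min_le_left _ _
      _ ≤ R * Real.sqrt G := key
      _ = ν' * G := this
  · -- large-residual branch: ν' G = R² / ν' ≥ R² > δ₀²
    have hRgt : δ₀ < R := lt_of_not_ge hRδ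
    have hR2 : δ₀ ^ 2 < R ^ 2 := by
      have := hδ₀.le
      nlinarith
    have hRsq : R ^ 2 = ν' * (ν' * G) := by
      have hsq2 : Real.sqrt G ^ 2 = G := Real.sq_sqrt hG0
      calc R ^ 2 = ν' ^ 2 * Real.sqrt G ^ 2 := by rw [hR]; ring
        _ = ν' * (ν' * G) := by rw [hsq2]; ring
    have hνG0 : 0 ≤ ν' * G := mul_nonneg hν'.le hG0
    have hle : R ^ 2 ≤ ν' * G := by
      rw [hRsq]
      calc ν' * (ν' * G) ≤ 1 * (ν' * G) := mul_le_mul_of_nonneg_right hν'1 hνG0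
        _ = ν' * G := one_mul _
    calc min c (δ₀ ^ 2) ≤ δ₀ ^ 2 := min_le_right _ _
      _ ≤ R ^ 2 := hR2.le
      _ ≤ ν' * G := hle

/-- **X ⇒ floor** (residual transfer discharged by the landed `residualTransferSSS_proof`, item 18616). -/
theorem gpEnsembleFloor_of_target (hX : GPStatisticalRigidity) :
    (∀ E : ℝ, ∃ ε₀ : ℝ, 0 < ε₀ ∧ ∀ ν : ℝ, 0 < ν → ν ≤ 1 →
      ∀ μ : Measure (Torus.energySpace (Fin 3)), Torus.IsStationaryStatisticalSolution ν gpForce μ →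
        Integrable (fun v : Torus.energySpace (Fin 3) => ‖v‖ ^ 2) μ → Torus.ensembleEnergy μ ≤ E →
          ε₀ ≤ Torus.ensembleDissipation ν μ) :=
  gpEnsembleFloor_of_target_of_residualTransfer hX residualTransferSSS_proof

/-! ### §3 R ∧ N ⇒ floor: the crux contains the ensemble zeroth law for `f_GP` -/

/-- **R ∧ N ⇒ the ensemble zeroth law for `f_GP` at every energy level.** Under the route's existence crux
N = `GPEulerCoercive`, the crux R = `TameToRough` implies the floor (`X ↔ N ∧ R`, then §2). -/
theorem gpEnsembleFloor_of_tameToRough (hR : TameToRough) (hN : GPEulerCoercive) :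
    (∀ E : ℝ, ∃ ε₀ : ℝ, 0 < ε₀ ∧ ∀ ν : ℝ, 0 < ν → ν ≤ 1 →
      ∀ μ : Measure (Torus.energySpace (Fin 3)), Torus.IsStationaryStatisticalSolution ν gpForce μ →
        Integrable (fun v : Torus.energySpace (Fin 3) => ‖v‖ ^ 2) μ → Torus.ensembleEnergy μ ≤ E →
          ε₀ ≤ Torus.ensembleDissipation ν μ) :=
  gpEnsembleFloor_of_target (target_iff_coercive_and_tameToRough.2 ⟨hN, hR⟩)

/-- The same with the tame GAP (R's own antecedent, `↔ N ∧ K`) in place of N: **R ∧ Gap ⇒ floor**. -/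
theorem gpEnsembleFloor_of_tameToRough_of_gap (hR : TameToRough)
    (hgap : ∀ E G₁ : ℝ, ∃ r : ℝ, 0 < r ∧ ∀ μ : Measure (Torus.energySpace (Fin 3)), IsProbabilityMeasure μ →
      Integrable (fun v : Torus.energySpace (Fin 3) => ‖v‖ ^ 2) μ → Torus.ensembleEnergy μ ≤ E →
        Torus.ensembleEnstrophy μ ≤ ENNReal.ofReal G₁ → ¬ DefectLE gpForce μ r) :
    (∀ E : ℝ, ∃ ε₀ : ℝ, 0 < ε₀ ∧ ∀ ν : ℝ, 0 < ν → ν ≤ 1 →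
      ∀ μ : Measure (Torus.energySpace (Fin 3)), Torus.IsStationaryStatisticalSolution ν gpForce μ →
        Integrable (fun v : Torus.energySpace (Fin 3) => ‖v‖ ^ 2) μ → Torus.ensembleEnergy μ ≤ E →
          ε₀ ≤ Torus.ensembleDissipation ν μ) :=
  gpEnsembleFloor_of_tameToRough hR (tameGap_iff.1 hgap).1

/-! ### §4 The floor is all the route consumes -/

/-- **The weaker node suffices.** The deciding theorem of route TameRoughRigidity goes through with the GP
ensemble floor in place of `(N, K, R, ResidualTransferSSS)`: floor at the family's level `E` (crux B),
transferred to each Leray–Hopf path by `EnsembleFloorTransfer`, then `∃`-introduction with `f := f_GP`. -/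
theorem anomalousDissipation_of_gpEnsembleFloor (hfloor : (∀ E : ℝ, ∃ ε₀ : ℝ, 0 < ε₀ ∧ ∀ ν : ℝ, 0 < ν → ν ≤ 1 →
      ∀ μ : Measure (Torus.energySpace (Fin 3)), Torus.IsStationaryStatisticalSolution ν gpForce μ →
        Integrable (fun v : Torus.energySpace (Fin 3) => ‖v‖ ^ 2) μ → Torus.ensembleEnergy μ ≤ E →
          ε₀ ≤ Torus.ensembleDissipation ν μ)) (h₄ : GPMeanBoundedFamily)
    (h₆ : EnsembleFloorTransfer) : _root_.AnomalousDissipation := by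
  obtain ⟨hsm, hdf, hzm⟩ :=
    Summit.AnomalousDissipation.AnomalousDissipation.Theorems.SteadyStatesLoudBounded.GpAdmissible.stub_gpAdmissible
  obtain ⟨E, ν, u₀, u, U, hν, hν0, hLH, hU, hE⟩ := h₄ gpForce rfl
  obtain ⟨ε₀, hε₀, hfl⟩ := hfloor E
  have hdissj : ∀ j, ε₀ ≤ Literature.Analysis.FluidPDE.meanDissipation (ν j) (u j) := fun j =>
    h₆ (ν j) E ε₀ gpForce (u₀ j) (u j) (U j) (hν j).1 hsm hdf hzm
      (fun μ hμ hint hEμ => hfl (ν j) (hν j).1 (hν j).2 μ hμ hint hEμ) (hLH j) (hU j) (hE j)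
  exact ⟨gpForce, hsm, hdf, hzm, ν, u₀, u, fun j => (hν j).1, hν0, hLH, ⟨E, hE⟩, ε₀, hε₀, hdissj⟩

/-- Hence, for this route, **R ∧ N can be traded for the floor**: `closes`' conclusion from
`(R, N, B, EnsembleFloorTransfer)` alone (K and the residual transfer are already theorems). -/
theorem anomalousDissipation_of_tameToRough (hR : TameToRough) (hN : GPEulerCoercive)
    (h₄ : GPMeanBoundedFamily) (h₆ : EnsembleFloorTransfer) : _root_.AnomalousDissipation :=
  anomalousDissipation_of_gpEnsembleFloor (gpEnsembleFloor_of_tameToRough hR hN) h₄ h₆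

/-! ### §5 Link with the Literature conjecture leaf turb.S08 at `f = f_GP` -/

/-- **Floor + any bounded-energy family of NS statistics ⇒ `EnsembleZerothLawAt f_GP`** (the registered open
conjecture turb.S08 of `Literature.Analysis.FluidPDE.StatisticalSolutions`, sequential `ε`-form, at the pinned
force). The family hypothesis is the ensemble analogue of crux B. -/
theorem ensembleZerothLawAt_gp_of_floor (hfloor : (∀ E : ℝ, ∃ ε₀ : ℝ, 0 < ε₀ ∧ ∀ ν : ℝ, 0 < ν → ν ≤ 1 →
      ∀ μ : Measure (Torus.energySpace (Fin 3)), Torus.IsStationaryStatisticalSolution ν gpForce μ →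
        Integrable (fun v : Torus.energySpace (Fin 3) => ‖v‖ ^ 2) μ → Torus.ensembleEnergy μ ≤ E →
          ε₀ ≤ Torus.ensembleDissipation ν μ))
    (hfam : ∃ (ν : ℕ → ℝ) (μ : ℕ → Measure (Torus.energySpace (Fin 3))), (∀ j, 0 < ν j ∧ ν j ≤ 1) ∧ Tendsto ν atTop (𝓝 0) ∧
      (∀ j, Torus.IsStationaryStatisticalSolution (ν j) gpForce (μ j)) ∧
      (∀ j, Integrable (fun v : Torus.energySpace (Fin 3) => ‖v‖ ^ 2) (μ j)) ∧ ∃ E : ℝ, ∀ j, Torus.ensembleEnergy (μ j) ≤ E) :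
    Literature.Analysis.FluidPDE.EnsembleZerothLawAt gpForce := by
  obtain ⟨ν, μ, hν, hν0, hsss, hint, E, hE⟩ := hfam
  obtain ⟨ε₀, hε₀, hfl⟩ := hfloor E
  exact ⟨ν, μ, fun j => (hν j).1, hν0, hsss, hint, ⟨E, hE⟩, ε₀, hε₀,
    fun j => hfl (ν j) (hν j).1 (hν j).2 (μ j) (hsss j) (hint j) (hE j)⟩

/-! ### The registered conjunction -/

/-- **`stub_zerothLawContentTools`** — `(X → floor) ∧ (R → N → floor) ∧ (floor → B → EFT → S) ∧ (R → N → B → EFT → S)`. -/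
theorem stub_zerothLawContentTools : (GPStatisticalRigidity → (∀ E : ℝ, ∃ ε₀ : ℝ, 0 < ε₀ ∧ ∀ ν : ℝ, 0 < ν → ν ≤ 1 → ∀ μ : Measure (Torus.energySpace (Fin 3)), Torus.IsStationaryStatisticalSolution ν gpForce μ → Integrable (fun v : Torus.energySpace (Fin 3) => ‖v‖ ^ 2) μ → Torus.ensembleEnergy μ ≤ E → ε₀ ≤ Torus.ensembleDissipation ν μ)) ∧ (TameToRough → GPEulerCoercive → (∀ E : ℝ, ∃ ε₀ : ℝ, 0 < ε₀ ∧ ∀ ν : ℝ, 0 < ν → ν ≤ 1 → ∀ μ : Measure (Torus.energySpace (Fin 3)), Torus.IsStationaryStatisticalSolution ν gpForce μ → Integrable (fun v : Torus.energySpace (Fin 3) => ‖v‖ ^ 2) μ → Torus.ensembleEnergy μ ≤ E → ε₀ ≤ Torus.ensembleDissipation ν μ)) ∧ ((∀ E : ℝ, ∃ ε₀ : ℝ, 0 < ε₀ ∧ ∀ ν : ℝ, 0 < ν → ν ≤ 1 → ∀ μ : Measure (Torus.energySpace (Fin 3)), Torus.IsStationaryStatisticalSolution ν gpForce μ → Integrable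 (fun v : Torus.energySpace (Fin 3) => ‖v‖ ^ 2) μ → Torus.ensembleEnergy μ ≤ E → ε₀ ≤ Torus.ensembleDissipation ν μ) → GPMeanBoundedFamily → EnsembleFloorTransfer → _root_.AnomalousDissipation) ∧ (TameToRough → GPEulerCoercive → GPMeanBoundedFamily → EnsembleFloorTransfer → _root_.AnomalousDissipation) :=
  ⟨gpEnsembleFloor_of_target, gpEnsembleFloor_of_tameToRough, anomalousDissipation_of_gpEnsembleFloor,
    anomalousDissipation_of_tameToRough⟩

end Summit.AnomalousDissipation.AnomalousDissipation.Theorems.TameRoughRigidity.TameToRough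

end
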